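import Summits.NavierStokesRegularity.NavierStokesRegularity.Theorems.RecurrentProfilesRecurrentLiouvilleFrOrbitModulus
import Summits.NavierStokesRegularity.NavierStokesRegularity.Theorems.RecurrentProfilesRecurrentLiouvilleFrCore
import Summits.NavierStokesRegularity.NavierStokesRegularity.Theorems.RecurrentProfilesRecurrentReductionOrbit
import Literature.Analysis.FluidPDE.ScalingUniformRecurrence
import Literature.Analysis.FluidPDE.SelfSimilar
import HarnessLib

/-!
# Crux `ForcedSymmetry` (stmt-NavierStokesRegularity-4052), line `closing-dichotomy` (gen c9) —
# sub-goal `rdss_of_almostPeriodsInWindow`: almost periods in ONE fixed window force self-similarity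

Theorems-only file (no definitions, no named facts).  The class: suitable weak solutions `(u, p)`
of Navier–Stokes (`ν = 1`, `f = 0`) on the backward slab `ℝ³ × ℝ₋ = (-∞, 0) × ℝ³` with a weak
spatial gradient `G` and finite Albritton–Barker quantity `𝐈(u, p, G) < ∞`; the scaling orbit
`σ ↦ u_{e^σ}`, `u_c(t, x) = c u(c² t, c x)` (`nsRescale c u`); distances in `L³(Q(0,1))`,
`Q(0, R) = ]-R², 0[ × B(0, R)`.

* `rdss_of_almostPeriodsInWindow` — **Bohr's "bounded inclusion ⇒ periodic" for the scaling
  orbit (a portrait of the enemy of the wall `stub_almostPeriodicLiouville`).**  Suppose that at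
  EVERY accuracy `δ > 0` the WHOLE orbit of `u` has a `δ`-almost period `σ` lying in one FIXED
  compact window `[a, b] ⊂ (0, ∞)`:  `sup_s ‖(u_{e^s})_{e^σ} − u_{e^s}‖_{L³(Q(0,1))} ≤ δ`.  Then `u`
  is discretely self-similar about the origin in the a.e. sense of the crux: for some `l > 1`,
  `l u(l² t, l x) = u(t, x)` for a.e. `(t, x) ∈ ℝ₋ × ℝ³` (the rotated-DSS clause with `R = 1`,
  `ξ = 0`, `τ = 0`).  Contrapositive: a non-self-similar almost periodic profile has ESCAPING almost
  periods (inclusion lengths `→ ∞` as `δ → 0`).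

Proof.  Pick almost periods `σ_k ∈ [a, b]` at accuracy `1/(k+1)` and a limit point `σ' ∈ [a, b]`
(Bolzano–Weierstrass).  For fixed `s`, the comparison point `W = u_{e^{s + σ_k}}` is a class member
with the SAME `𝐈` (`zoom_slabProfile`) and `(u_{e^s})_{e^{σ'}} = W_{e^{σ' − σ_k}}`, so the
class-uniform orbit modulus (`stub_frOrbitModulus`: A–B compactness + orbit continuity) and the
almost-period bound give `‖(u_{e^s})_{e^{σ'}} − u_{e^s}‖_{L³(Q(0,1))} ≤ ε + 1/(k+1)` for every
`ε > 0` and all large `k`; hence this quantity vanishes for every `s`.  At `s = log (n+1)` the exact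
scaling law `‖v_c − w_c‖_{L³(Q(0,1))} = c (c⁵)^{-1/3} ‖v − w‖_{L³(Q(0,c))}` (`eLpNorm_zoom_sub_zoom`)
gives `‖u_{e^{σ'}} − u‖_{L³(Q(0, n+1))} = 0`, so `u_{e^{σ'}} = u` a.e. on `⋃ₙ Q(0, n+1) ⊇ ℝ₋ × ℝ³`;
`l = e^{σ'} ≥ e^a > 1`.

## References

* H. Bohr, *Almost Periodic Functions* (1947), §§44–46 (almost periods, inclusion length). [folklore]
* D. Albritton, T. Barker, J. Math. Fluid Mech. 21 (2019), no. 43 = arXiv:1811.00502, Lemma 2.2,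
  §3. [AlbrittonBarker2019]
* D. Chae, J. Wolf, arXiv:1610.09464, Thm 1.3 (the DSS rung). [ChaeWolf2017RemovingDSS]
-/

noncomputable section

-- the sub-problem namespace repeats the summit name (D-0017 layout `Summit.<S>.<P>.Theorems`)
set_option linter.dupNamespace false

namespace Summit.NavierStokesRegularity.NavierStokesRegularity.Theorems

open MeasureTheory Set Function Filter Topology TopologicalSpace Metric
open Literature.Analysis Literature.Analysis.FluidPDE
open scoped NNReal ENNReal

variable {u : ℝ → EuclideanSpace ℝ (Fin 3) → EuclideanSpace ℝ (Fin 3)}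
  {p : ℝ → EuclideanSpace ℝ (Fin 3) → ℝ}
  {G : ℝ → EuclideanSpace ℝ (Fin 3) → EuclideanSpace ℝ (Fin 3) →L[ℝ] EuclideanSpace ℝ (Fin 3)}

/-! ### Bookkeeping along the orbit -/

/-- The scaling constant `c (c⁵)^{-1/3}` of `eLpNorm_zoom_sub_zoom` is nonzero for `c > 0`.
[folklore] -/
private theorem apWindow_zoomConst_ne_zero {c : ℝ} (hc : 0 < c) :
    ‖c‖ₑ * (ENNReal.ofReal (c ^ 2 * c ^ 3)⁻¹) ^ (1 / (3 : ℝ≥0∞).toReal) ≠ 0 := by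
  -- adapted from `frEpochRemoval_zoomConst_ne_zero` (RecurrentProfilesRecurrentLiouvilleFrEpochRemoval)
  refine mul_ne_zero ?_ ?_
  · simpa using hc.ne'
  · exact (ENNReal.rpow_pos (ENNReal.ofReal_pos.2 (by positivity)) ENNReal.ofReal_ne_top).ne'

/-- The inverse of the identity isometry is the identity. [folklore] -/
private theorem apWindow_refl_symm :
    (LinearIsometryEquiv.refl ℝ (EuclideanSpace ℝ (Fin 3))).symm =
      LinearIsometryEquiv.refl ℝ (EuclideanSpace ℝ (Fin 3)) :=
  rfl

/-- **Orbit points are class members with the same `𝐈`.**  For a suitable weak solution `(u, p)`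
on `ℝ³ × ℝ₋` with weak gradient `G`, every orbit point `u_{e^τ}` is a suitable weak solution on
`ℝ³ × ℝ₋` (pressure `e^{2τ} p ∘ Φ`, gradient `e^{2τ} G ∘ Φ`) with the same Albritton–Barker quantity
(`zoom_slabProfile`, `nsRescale_eq_zoom`). [cite: AlbrittonBarker2019, §3] -/
private theorem apWindow_cls
    (hsw : IsSuitableWeakSolutionOn (slab (EuclideanSpace ℝ (Fin 3)) (Iio 0) isOpen_Iio) 1 0 u p)
    (hwg : HasWeakSpatialGradientOn (slab (EuclideanSpace ℝ (Fin 3)) (Iio 0) isOpen_Iio) u G)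
    (τ : ℝ) :
    IsSuitableWeakSolutionOn (slab (EuclideanSpace ℝ (Fin 3)) (Iio 0) isOpen_Iio) 1 0
        (nsRescale (Real.exp τ) u)
        ((Real.exp τ) ^ 2 • stPull ((Real.exp τ) ^ 2) (Real.exp τ) (0 : ℝ)
          (0 : EuclideanSpace ℝ (Fin 3)) p) ∧
      HasWeakSpatialGradientOn (slab (EuclideanSpace ℝ (Fin 3)) (Iio 0) isOpen_Iio)
        (nsRescale (Real.exp τ) u)
        ((Real.exp τ) ^ 2 • stPull ((Real.exp τ) ^ 2) (Real.exp τ) (0 : ℝ)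
          (0 : EuclideanSpace ℝ (Fin 3)) G) ∧
      typeIBound (Iio (0 : ℝ) ×ˢ univ) (nsRescale (Real.exp τ) u)
          ((Real.exp τ) ^ 2 • stPull ((Real.exp τ) ^ 2) (Real.exp τ) (0 : ℝ)
            (0 : EuclideanSpace ℝ (Fin 3)) p)
          ((Real.exp τ) ^ 2 • stPull ((Real.exp τ) ^ 2) (Real.exp τ) (0 : ℝ)
            (0 : EuclideanSpace ℝ (Fin 3)) G) =
        typeIBound (Iio (0 : ℝ) ×ˢ univ) u p G := by
  -- adapted from `frCore_epoch_of_modulus_of_epochRemoval` (the `hcls` step)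
  have hz := zoom_slabProfile hsw hwg (Real.exp_pos τ)
  refine ⟨?_, ?_, ?_⟩
  · rw [nsRescale_eq_zoom]; exact hz.1
  · rw [nsRescale_eq_zoom]; exact hz.2.1
  · rw [nsRescale_eq_zoom]; exact hz.2.2

/-- **One comparison step.**  If the class `{𝐈 ≤ 𝐈(u)}` has the orbit modulus `(r, ε)` in
`L³(Q(0,1))`, `σ₁` is a `d`-almost period of the whole orbit of `u`, and `|σ' − σ₁| ≤ r`, then
`‖(u_{e^s})_{e^{σ'}} − u_{e^s}‖_{L³(Q(0,1))} ≤ ε + d` for every `s`: with the class member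
`W = u_{e^{s + σ₁}}` one has `(u_{e^s})_{e^{σ'}} = W_{e^{σ' − σ₁}}` and `(u_{e^s})_{e^{σ₁}} = W`
(Minkowski). [cite: AlbrittonBarker2019, Lemma 2.2] -/
private theorem apWindow_step
    (hsw : IsSuitableWeakSolutionOn (slab (EuclideanSpace ℝ (Fin 3)) (Iio 0) isOpen_Iio) 1 0 u p)
    (hwg : HasWeakSpatialGradientOn (slab (EuclideanSpace ℝ (Fin 3)) (Iio 0) isOpen_Iio) u G)
    {r ε : ℝ}
    (hmod : ∀ (v : ℝ → EuclideanSpace ℝ (Fin 3) → EuclideanSpace ℝ (Fin 3))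
        (q : ℝ → EuclideanSpace ℝ (Fin 3) → ℝ)
        (H : ℝ → EuclideanSpace ℝ (Fin 3) → EuclideanSpace ℝ (Fin 3) →L[ℝ] EuclideanSpace ℝ (Fin 3)),
        IsSuitableWeakSolutionOn (slab (EuclideanSpace ℝ (Fin 3)) (Iio 0) isOpen_Iio) 1 0 v q →
        HasWeakSpatialGradientOn (slab (EuclideanSpace ℝ (Fin 3)) (Iio 0) isOpen_Iio) v H →
        typeIBound (Iio (0 : ℝ) ×ˢ univ) v q H ≤ typeIBound (Iio (0 : ℝ) ×ˢ univ) u p G →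
        ∀ σ : ℝ, |σ| ≤ r →
          eLpNorm (uncurry (nsRescale (Real.exp σ) v) - uncurry v) 3
            (volume.restrict (parabolicCylinder 1 (0 : ℝ × EuclideanSpace ℝ (Fin 3)))) ≤
              ENNReal.ofReal ε)
    {σ₁ σ' : ℝ} (hσ : |σ' - σ₁| ≤ r) {d : ℝ≥0∞}
    (hap : ∀ s : ℝ, eLpNorm (fun z : ℝ × EuclideanSpace ℝ (Fin 3) =>
        nsRescale (Real.exp σ₁) (nsRescale (Real.exp s) u) z.1 z.2 - nsRescale (Real.exp s) u z.1 z.2) 3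
        (volume.restrict (parabolicCylinder 1 (0 : ℝ × EuclideanSpace ℝ (Fin 3)))) ≤ d)
    (s : ℝ) :
    eLpNorm (fun z : ℝ × EuclideanSpace ℝ (Fin 3) =>
        nsRescale (Real.exp σ') (nsRescale (Real.exp s) u) z.1 z.2 - nsRescale (Real.exp s) u z.1 z.2) 3
        (volume.restrict (parabolicCylinder 1 (0 : ℝ × EuclideanSpace ℝ (Fin 3)))) ≤
      ENNReal.ofReal ε + d := by
  -- the comparison orbit point `W = u_{e^{s + σ₁}}`, a class member with the same `𝐈`
  have hcls := apWindow_cls hsw hwg (s + σ₁)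
  have hgap := hmod _ _ _ hcls.1 hcls.2.1 hcls.2.2.le (σ' - σ₁) hσ
  rw [frCore_nsRescale_exp_exp, show s + σ₁ + (σ' - σ₁) = s + σ' by ring] at hgap
  have hret := hap s
  rw [frCore_nsRescale_exp_exp] at hret
  rw [frCore_nsRescale_exp_exp]
  -- measurability on the unit ball
  have hm' : AEStronglyMeasurable (uncurry (nsRescale (Real.exp (s + σ')) u))
      (volume.restrict (parabolicCylinder 1 (0 : ℝ × EuclideanSpace ℝ (Fin 3)))) :=
    frCore_aestronglyMeasurable_nsRescale hsw hwg (Real.exp_pos _)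
  have hm₁ : AEStronglyMeasurable (uncurry (nsRescale (Real.exp (s + σ₁)) u))
      (volume.restrict (parabolicCylinder 1 (0 : ℝ × EuclideanSpace ℝ (Fin 3)))) :=
    frCore_aestronglyMeasurable_nsRescale hsw hwg (Real.exp_pos _)
  have hm₀ : AEStronglyMeasurable (uncurry (nsRescale (Real.exp s) u))
      (volume.restrict (parabolicCylinder 1 (0 : ℝ × EuclideanSpace ℝ (Fin 3)))) :=
    frCore_aestronglyMeasurable_nsRescale hsw hwg (Real.exp_pos _)
  calc eLpNorm (fun z : ℝ × EuclideanSpace ℝ (Fin 3) =>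
        nsRescale (Real.exp (s + σ')) u z.1 z.2 - nsRescale (Real.exp s) u z.1 z.2) 3
        (volume.restrict (parabolicCylinder 1 (0 : ℝ × EuclideanSpace ℝ (Fin 3))))
      = eLpNorm ((uncurry (nsRescale (Real.exp (s + σ')) u) - uncurry (nsRescale (Real.exp (s + σ₁)) u)) +
          (uncurry (nsRescale (Real.exp (s + σ₁)) u) - uncurry (nsRescale (Real.exp s) u))) 3
          (volume.restrict (parabolicCylinder 1 (0 : ℝ × EuclideanSpace ℝ (Fin 3)))) := by
        rw [sub_add_sub_cancel]; rfl
    _ ≤ eLpNorm (uncurry (nsRescale (Real.exp (s + σ')) u) - uncurry (nsRescale (Real.exp (s + σ₁)) u)) 3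
          (volume.restrict (parabolicCylinder 1 (0 : ℝ × EuclideanSpace ℝ (Fin 3)))) +
        eLpNorm (uncurry (nsRescale (Real.exp (s + σ₁)) u) - uncurry (nsRescale (Real.exp s) u)) 3
          (volume.restrict (parabolicCylinder 1 (0 : ℝ × EuclideanSpace ℝ (Fin 3)))) :=
        eLpNorm_add_le (hm'.sub hm₁) (hm₁.sub hm₀) (by norm_num)
    _ ≤ ENNReal.ofReal ε + d := add_le_add hgap hret

/-- **A lag at which the orbit distance vanishes identically is an a.e. period.**  If
`‖(u_{e^s})_{e^{σ'}} − u_{e^s}‖_{L³(Q(0,1))} = 0` for every `s`, then `u_{e^{σ'}} = u` almost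
everywhere on `ℝ₋ × ℝ³`: at `s = log (n+1)` the exact scaling law (`eLpNorm_zoom_sub_zoom`) gives
`‖u_{e^{σ'}} − u‖_{L³(Q(0, n+1))} = 0`, and the balls `Q(0, n+1)` exhaust the slab. [folklore] -/
private theorem apWindow_ae_eq
    (hsw : IsSuitableWeakSolutionOn (slab (EuclideanSpace ℝ (Fin 3)) (Iio 0) isOpen_Iio) 1 0 u p)
    (hwg : HasWeakSpatialGradientOn (slab (EuclideanSpace ℝ (Fin 3)) (Iio 0) isOpen_Iio) u G)
    {σ' : ℝ}
    (h : ∀ s : ℝ, eLpNorm (fun z : ℝ × EuclideanSpace ℝ (Fin 3) =>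
        nsRescale (Real.exp σ') (nsRescale (Real.exp s) u) z.1 z.2 - nsRescale (Real.exp s) u z.1 z.2) 3
        (volume.restrict (parabolicCylinder 1 (0 : ℝ × EuclideanSpace ℝ (Fin 3)))) = 0) :
    ∀ᵐ z ∂(volume.restrict (Iio (0 : ℝ) ×ˢ (univ : Set (EuclideanSpace ℝ (Fin 3))))),
      nsRescale (Real.exp σ') u z.1 z.2 = u z.1 z.2 := by
  refine ae_restrict_of_ae_restrict_of_subset lowerHalf_subset_iUnion_parabolicCylinder ?_
  rw [ae_restrict_iUnion_iff]
  intro n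
  have hρ : (0 : ℝ) < (n : ℝ) + 1 := by positivity
  -- at `s = log (n+1)`: `(u_{e^s})_{e^{σ'}} − u_{e^s} = (u_{e^{σ'}})_{n+1} − u_{n+1}` on `Q(0, 1)`
  have h0 := h (Real.log ((n : ℝ) + 1))
  rw [Real.exp_log hρ, nsRescale_comm] at h0
  -- the exact scaling law of `L³` distances
  have key := eLpNorm_zoom_sub_zoom (nsRescale (Real.exp σ') u) u hρ 1
  rw [mul_one, ← nsRescale_eq_zoom, ← nsRescale_eq_zoom] at key
  have e1 : uncurry (nsRescale ((n : ℝ) + 1) (nsRescale (Real.exp σ') u)) -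
      uncurry (nsRescale ((n : ℝ) + 1) u) =
      fun z : ℝ × EuclideanSpace ℝ (Fin 3) =>
        nsRescale ((n : ℝ) + 1) (nsRescale (Real.exp σ') u) z.1 z.2 - nsRescale ((n : ℝ) + 1) u z.1 z.2 :=
    rfl
  rw [e1, h0] at key
  have hzero : eLpNorm (uncurry (nsRescale (Real.exp σ') u) - uncurry u) 3
      (volume.restrict (parabolicCylinder ((n : ℝ) + 1) (0 : ℝ × EuclideanSpace ℝ (Fin 3)))) = 0 := by
    rcases mul_eq_zero.1 key.symm with hκ | hF
    · exact absurd hκ (apWindow_zoomConst_ne_zero hρ)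
    · exact hF
  -- `L³`-null difference on the ball is an a.e. equality
  have hm : AEStronglyMeasurable (uncurry (nsRescale (Real.exp σ') u) - uncurry u)
      (volume.restrict (parabolicCylinder ((n : ℝ) + 1) (0 : ℝ × EuclideanSpace ℝ (Fin 3)))) :=
    (frCore_aestronglyMeasurable_nsRescale hsw hwg (Real.exp_pos _)).sub
      (frCore_aestronglyMeasurable hwg)
  have hae := (eLpNorm_eq_zero_iff hm (by norm_num)).1 hzero
  filter_upwards [hae] with z hz
  exact sub_eq_zero.1 hz

/-! ### The registered sub-goal -/

/-- **Sub-goal `rdss_of_almostPeriodsInWindow`** (crux stmt-NavierStokesRegularity-4052, line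
`closing-dichotomy`): **almost periods of the whole scaling orbit in ONE fixed window force discrete
self-similarity** (Bohr: bounded inclusion length ⇒ periodic).  Let `(u, p)` be a suitable weak
solution on `ℝ³ × ℝ₋` with weak gradient `G` and `𝐈 < ∞`.  If there is a window `[a, b]`,
`0 < a ≤ b`, containing for EVERY `δ > 0` a log-scale `σ` with
`‖(u_{e^s})_{e^σ} − u_{e^s}‖_{L³(Q(0,1))} ≤ δ` for all `s`, then for some `l > 1` (namely
`l = e^{σ'}`, `σ'` a limit of such almost periods as `δ → 0`) `l u(l² t, l x) = u(t, x)` for a.e.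
`(t, x) ∈ ℝ₋ × ℝ³` — the rotated-DSS clause with `R = 1`, `ξ = 0`, `τ = 0`.  Ingredients:
Bolzano–Weierstrass in `[a, b]`, the class-uniform orbit modulus `stub_frOrbitModulus`
(Albritton–Barker compactness), the group law `(u_{e^σ})_{e^τ} = u_{e^{σ+τ}}`, the exact scaling law
of `L³` distances and the exhaustion of the slab by `Q(0, n+1)`.
[cite: AlbrittonBarker2019, Lemma 2.2] -/
theorem rdss_of_almostPeriodsInWindow :
    ∀ (u : ℝ → EuclideanSpace ℝ (Fin 3) → EuclideanSpace ℝ (Fin 3))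
      (p : ℝ → EuclideanSpace ℝ (Fin 3) → ℝ)
      (G : ℝ → EuclideanSpace ℝ (Fin 3) → EuclideanSpace ℝ (Fin 3) →L[ℝ] EuclideanSpace ℝ (Fin 3)),
      IsSuitableWeakSolutionOn (slab (EuclideanSpace ℝ (Fin 3)) (Set.Iio 0) isOpen_Iio) 1 0 u p →
      HasWeakSpatialGradientOn (slab (EuclideanSpace ℝ (Fin 3)) (Set.Iio 0) isOpen_Iio) u G →
      typeIBound (Set.Iio (0 : ℝ) ×ˢ Set.univ) u p G < ⊤ →
      (∃ a b : ℝ, 0 < a ∧ a ≤ b ∧ ∀ δ : ℝ, 0 < δ → ∃ σ ∈ Set.Icc a b, ∀ s : ℝ,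
        eLpNorm (fun z : ℝ × EuclideanSpace ℝ (Fin 3) =>
            nsRescale (Real.exp σ) (nsRescale (Real.exp s) u) z.1 z.2 - nsRescale (Real.exp s) u z.1 z.2) 3
          (volume.restrict (parabolicCylinder 1 (0 : ℝ × EuclideanSpace ℝ (Fin 3)))) ≤
          ENNReal.ofReal δ) →
      ∃ l : ℝ, 1 < l ∧ ∃ (R : EuclideanSpace ℝ (Fin 3) ≃ₗᵢ[ℝ] EuclideanSpace ℝ (Fin 3))
        (ξ : EuclideanSpace ℝ (Fin 3)) (τ : ℝ), τ ≤ 0 ∧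
        (fun z : ℝ × EuclideanSpace ℝ (Fin 3) => l • R.symm (u (l ^ 2 * z.1 + τ) (l • R z.2 + ξ)))
          =ᵐ[volume.restrict (Set.Iio (0 : ℝ) ×ˢ Set.univ)]
        (fun z : ℝ × EuclideanSpace ℝ (Fin 3) => u z.1 z.2) := by
  intro u p G hsw hwg hI hap
  obtain ⟨a, b, ha, -, hwin⟩ := hap
  -- (1) almost periods `σ_k ∈ [a, b]` of the whole orbit at accuracy `1/(k+1)`
  have hδk : ∀ k : ℕ, (0 : ℝ) < 1 / ((k : ℝ) + 1) := fun k => by positivity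
  choose σ hσ hbound using fun k : ℕ => hwin _ (hδk k)
  -- (2) Bolzano–Weierstrass in the compact window
  obtain ⟨σ', hσ', φ, hφ, hlim⟩ := isCompact_Icc.tendsto_subseq hσ
  -- (3) the orbit distance at lag `σ'` vanishes identically in `s`
  have hkey : ∀ s : ℝ, eLpNorm (fun z : ℝ × EuclideanSpace ℝ (Fin 3) =>
      nsRescale (Real.exp σ') (nsRescale (Real.exp s) u) z.1 z.2 - nsRescale (Real.exp s) u z.1 z.2) 3
      (volume.restrict (parabolicCylinder 1 (0 : ℝ × EuclideanSpace ℝ (Fin 3)))) = 0 := by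
    intro s
    refine le_antisymm (ENNReal.le_of_forall_pos_le_add fun ε hε _ => ?_) zero_le
    rw [zero_add]
    have hε2 : (0 : ℝ) < (ε : ℝ) / 2 := half_pos (NNReal.coe_pos.2 hε)
    -- the class-uniform orbit modulus at accuracy `ε/2` for the class `{𝐈 ≤ 𝐈(u)}`
    obtain ⟨r, hr, hmod⟩ := stub_frOrbitModulus _ hI ((ε : ℝ) / 2) hε2
    -- a large index: `|σ' − σ_{φ j}| ≤ r` and `1/(φ j + 1) < ε/2`
    have hδφ : Tendsto (fun j : ℕ => 1 / (((φ j : ℕ) : ℝ) + 1)) atTop (𝓝 0) :=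
      (tendsto_one_div_add_atTop_nhds_zero_nat (𝕜 := ℝ)).comp hφ.tendsto_atTop
    have h1 : ∀ᶠ j in atTop, dist (σ (φ j)) σ' < r := Metric.tendsto_nhds.1 hlim r hr
    have h2 : ∀ᶠ j in atTop, 1 / (((φ j : ℕ) : ℝ) + 1) < (ε : ℝ) / 2 :=
      hδφ.eventually (eventually_lt_nhds hε2)
    obtain ⟨j, hj1, hj2⟩ := (h1.and h2).exists
    have hσj : |σ' - σ (φ j)| ≤ r := by
      rw [abs_sub_comm, ← Real.dist_eq]
      exact hj1.le
    refine (apWindow_step hsw hwg hmod hσj (hbound (φ j)) s).trans ?_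
    calc ENNReal.ofReal ((ε : ℝ) / 2) + ENNReal.ofReal (1 / (((φ j : ℕ) : ℝ) + 1))
        ≤ ENNReal.ofReal ((ε : ℝ) / 2) + ENNReal.ofReal ((ε : ℝ) / 2) :=
          add_le_add le_rfl (ENNReal.ofReal_le_ofReal hj2.le)
      _ = ε := by
          rw [← ENNReal.ofReal_add hε2.le hε2.le, add_halves, ENNReal.ofReal_coe_nnreal]
  -- (4) hence `u_{e^{σ'}} = u` almost everywhere on the slab
  have hae := apWindow_ae_eq hsw hwg hkey
  -- (5) the rotated-DSS clause with `l = e^{σ'} > 1`, `R = 1`, `ξ = 0`, `τ = 0`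
  refine ⟨Real.exp σ', Real.one_lt_exp_iff.2 (ha.trans_le hσ'.1),
    LinearIsometryEquiv.refl ℝ (EuclideanSpace ℝ (Fin 3)), 0, 0, le_rfl, ?_⟩
  filter_upwards [hae] with z hz
  simp only [add_zero, apWindow_refl_symm, LinearIsometryEquiv.coe_refl, id_eq]
  rw [nsRescale_apply] at hz
  exact hz

end Summit.NavierStokesRegularity.NavierStokesRegularity.Theorems

end
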